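import Mathlib
import HarnessLib
import Summits.HubbardSuperconductivity.HubbardSuperconductivity.Theorems.KLProgrammeKLRegimeWickCrossContractionGramValueB

/-!
# Route `KLProgramme` — ENGINE child gen 6 (stmt-HubbardSuperconductivity-20236 `KLRegimeEngineV16`), `stub_engine_step_values` (E2-v10):
# the value form with a Gram tail for a FINITE SYMBOL FAMILY — the `k`-UNIFORM Gram base the line-number tail needs
# (cell gate-hubbard-kl, seat p5 g5; supersedes the keying of `…GramValue` §2–§3 / `…GramValueB` §2 / `…GramTwoFamilies` for the tail)

`…GramValue.norm_kernel_crossContract_value_pullback_le_gram` indexes the Gram data by the LINES (`κ : Fin k → ℝ`, base `Σ_{i<k} κ_i²`): true, but the base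
grows with `k`, so `(Σ_{i<k} κ_i²)^{k−e'−1} ∼ (k·κ²)^{k−e'−1}` is NOT summable in the line number.  The terms of the Wick step carry only finitely many
distinct symbols (the slice `g_{n+1}` at line `0`, the soft covariances `D_n`, `D_{n+1}` — `listProd_cons_append_const`), so the right keying is by a finite
SYMBOL FAMILY `sym : ι → symbols` with an assignment `τ : Fin k → ι` of lines to symbols: the Gram base is `Σ_{s ∈ ι} κ_s²`, independent of `k`
(`Literature.….norm_det_contr_le_of_gram` and `norm_kernel_crossContract_value_le_gram(_of_b)` are already stated this way).  Here the pullback and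
engine-currency statements in that keying, lines pulled back by the fat family `Ft`, vertices the `F`-sector preimages:

* **`norm_kernel_crossContract_value_pullback_le_gramF`** / **`…_of_b`** — arbitrary vertices `a`, `b`;
* **`norm_kernel_crossContract_value_sectorPreimage_le_gramF`** / **`…_of_b`** — `Ga` at `F`-level `m₀ + 1` (resp. `e' + 1 + m₀`), `Gb` at `F`-level
  `e' + 1 + m₁` (resp. `m₁ + 1`); bound `((k+…)!(k+…)!/(m!·(k−e'−1)!))·(Σ_{s∈ι} κ_s²)^{k−e'−1}·α·∏_{i<e'}(δ_i·4ρ₀)·(εNa)(εNb)` — with the `(k!)⁻¹` of the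
  exponential series: `poly(k)·(Σ_sκ_s²)^{k−e'−1}`, geometric in `k`;
* `norm_kernel_crossContract_value_klAnisoPreimage_le_gramF` / `…_of_b` — the vertices the `klAnisoFamily … e₀ n`-sector preimages (the (E1)/(E1-F)
  carriers), any fat transport family `Ft` with overlap count `ρ₀`.

Pure bookkeeping; no definitions, no named facts.
-/

noncomputable section

namespace Summit.HubbardSuperconductivity.HubbardSuperconductivity.Theorems.KLRegimeWick

set_option linter.dupNamespace false -- summit = problem name (single-conjunct summit), D-0017

open Literature.MathematicalPhysics.QuantumLattice Literature.Probability.LatticeModels GrassmannAlgebra Finset Matrix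
open Summit.HubbardSuperconductivity.HubbardSuperconductivity.Theorems.KLRegimeSplit
open scoped InnerProductSpace

section Family

variable {L M N : ℕ} [NeZero L] {ι : Type*} [Fintype ι] [DecidableEq ι]

/-- Charges in `Fin 2` with `[a = 0] ↔ [b = 0]` are equal. -/
private theorem fin_two_eq_of_iff {a b : Fin 2} (h : a = 0 ↔ b = 0) : a = b := by
  rw [Fin.ext_iff, Fin.ext_iff, Fin.val_zero] at h
  rw [Fin.ext_iff]
  have ha := a.isLt
  have hb := b.isLt
  omega

/-- **Value form with a Gram tail for a finite symbol family** (lines `S(Ft)ᵀ·C_{sym (τ i)}·S(Ft)`, Gram base `Σ_{s∈ι} κ_s²` independent of `k`;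
`m₀ + 1 ≥ 1`… here `m₀` output legs from `a` with `a` anchored at its free legs as in `…_value_le_gram`). [cite: BenfattoGiulianiMastropietro2006, §2.8 (2.80)] -/
theorem norm_kernel_crossContract_value_pullback_le_gramF {k e' m m₀ m₁ : ℕ} (he : e' + 1 ≤ k) (β : ℝ) (Ft : Fin N → FreqMomentum L M → ℂ)
    {ρ₀ : ℕ} (hρ₀ : ∀ ω : Fin N, ((univ : Finset (Fin N)).filter fun ω' => ∃ q, Ft ω q * Ft ω' q ≠ 0).card ≤ ρ₀)
    (sym : ι → FreqMomentum L M × Fin 2 → ℂ) (τ : Fin k → ι) (κ : ι → ℝ)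
    (hκF : ∀ (s : ι) (Y : SpaceTimeIdx L M × SectorLeg N), Y.2.2 = 0 → ‖sectorGramF L M β Ft (sym s) Y‖ ≤ κ s)
    (hκG : ∀ (s : ι) (Y : SpaceTimeIdx L M × SectorLeg N), Y.2.2 = 1 → ‖sectorGramG L M β Ft (sym s) Y‖ ≤ κ s)
    (a b : GrassmannAlgebra ℂ (SpaceTimeIdx L M × SectorLeg N)) (s : Fin m → Fin 2)
    (hm₀ : (univ.filter fun i => s i = 0).card = m₀) (hm₁ : (univ.filter fun i => s i = 1).card = m₁)
    (Z : Fin m → SpaceTimeIdx L M × SectorLeg N) {α : ℝ} (hα : 0 ≤ α)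
    (hrow : ∀ X, ∑ Y, ‖((sectorSubMatrix L M β Ft).transpose * normalCovariance L M (sym (τ (Fin.castLE he 0))) * sectorSubMatrix L M β Ft) X Y‖ ≤ α)
    (hcol : ∀ Y, ∑ X, ‖((sectorSubMatrix L M β Ft).transpose * normalCovariance L M (sym (τ (Fin.castLE he 0))) * sectorSubMatrix L M β Ft) X Y‖ ≤ α)
    (δ : Fin e' → ℝ) (hδ : ∀ i, 0 ≤ δ i)
    (hent : ∀ (i : Fin e') X Y,
      ‖((sectorSubMatrix L M β Ft).transpose * normalCovariance L M (sym (τ (Fin.castLE he i.succ))) * sectorSubMatrix L M β Ft) X Y‖ ≤ δ i)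
    {Na Nb : ℝ} (hNb0 : 0 ≤ Nb)
    (hNa : ∀ X₀ : Fin m₀ → SpaceTimeIdx L M × SectorLeg N, ∑ X : Fin k → SpaceTimeIdx L M × SectorLeg N,
      ‖kernel ℂ a (k + m₀) (Fin.append X X₀)‖ ≤ Na)
    (hNb : ∀ (Y₀ : SpaceTimeIdx L M × SectorLeg N) (τ' : Fin e' → SectorLeg N) (Y₁ : Fin m₁ → SpaceTimeIdx L M × SectorLeg N),
      ∑ y : Fin e' → SpaceTimeIdx L M, ∑ Y ∈ univ.filter (fun Y : Fin k → SpaceTimeIdx L M × SectorLeg N =>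
        (fun i => Y (Fin.castLE he i)) = (Fin.cons Y₀ (fun i => (y i, τ' i)) : Fin (e' + 1) → SpaceTimeIdx L M × SectorLeg N)),
          ‖kernel ℂ b (k + m₁) (Fin.append Y Y₁)‖ ≤ Nb) :
    ‖kernel ℂ (((List.ofFn fun i => grassmannLaplacian ℂ (crossCov ℂ
        ((sectorSubMatrix L M β Ft).transpose * normalCovariance L M (sym (τ i)) * sectorSubMatrix L M β Ft))).reverse).prod
        (dblCopy ℂ 0 a * dblCopy ℂ 1 b)) m (fun i => (Z i, s i))‖ ≤
      (((k + m₀).factorial * (k + m₁).factorial : ℝ) / (m.factorial * (k - (e' + 1)).factorial)) * (∑ t, κ t ^ 2) ^ (k - (e' + 1)) *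
        (α * (∏ i, δ i * ((4 * ρ₀ : ℕ) : ℝ)) * Na * Nb) := by
  classical
  refine norm_kernel_crossContract_value_le_gram (fun Y : SpaceTimeIdx L M × SectorLeg N => decide (Y.2.2 = 0))
    (fun t => (sectorSubMatrix L M β Ft).transpose * normalCovariance L M (sym t) * sectorSubMatrix L M β Ft)
    (fun t X Y hq => pullback_normalCovariance_apply_of_charge_eq β Ft (sym t) (fin_two_eq_of_iff (by simpa using hq)))
    (fun t => sectorGramF L M β Ft (sym t)) (fun t => sectorGramG L M β Ft (sym t)) κ
    (fun t X hX => hκF t X (by simpa using hX)) (fun t Y hY => hκG t Y ?_)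
    (fun t X Y hX hY => contr_pullback_normalCovariance_eq_inner β Ft (sym t) (by simpa using hX) ?_)
    he (fun i => (sectorSubMatrix L M β Ft).transpose * normalCovariance L M (sym (τ i)) * sectorSubMatrix L M β Ft) τ (fun i _ => rfl)
    a b s hm₀ hm₁ Z hα (sum_norm_contr_le _ hrow hcol)
    (fun _ σ τ'' => if (∃ q, Ft σ.1.1 q * Ft τ''.1.1 q ≠ 0) then (1 : ℝ) else 0) (fun _ σ τ'' => by positivity)
    δ (fun _ => ((4 * ρ₀ : ℕ) : ℝ)) hδ (fun _ => by positivity)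
    (fun i X Y => norm_contr_le_indicator_of_support _ (fun σ τ'' : SectorLeg N => ∃ q, Ft σ.1.1 q * Ft τ''.1.1 q ≠ 0)
      (fun σ τ'' ⟨q, hq⟩ => ⟨q, by rwa [mul_comm] at hq⟩) (hδ i) (hent i)
      (fun X Y hXY => exists_mul_ne_zero_of_pullback_normalCovariance_ne_zero β Ft (sym _) hXY) X Y)
    (fun _ σ => sum_indicator_le_of_card_le (fun σ τ'' : SectorLeg N => ∃ q, Ft σ.1.1 q * Ft τ''.1.1 q ≠ 0) (fun σ' => ?_) σ) hNb0 hNa hNb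
  · have h2 : (Y.2.2 : Fin 2) ≠ 0 := by simpa using hY
    omega
  · have h2 : (Y.2.2 : Fin 2) ≠ 0 := by simpa using hY
    omega
  · exact (card_filter_sectorLeg_le fun ω' => ∃ q, Ft σ'.1.1 q * Ft ω' q ≠ 0).trans (Nat.mul_le_mul_left 4 (hρ₀ σ'.1.1))

/-- **The same, roles exchanged** (`a` anchored at its line-`0` leg, `b` at its free legs). [cite: BenfattoGiulianiMastropietro2006, §2.8 (2.80)] -/
theorem norm_kernel_crossContract_value_pullback_le_gramF_of_b {k e' m m₀ m₁ : ℕ} (he : e' + 1 ≤ k) (β : ℝ) (Ft : Fin N → FreqMomentum L M → ℂ)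
    {ρ₀ : ℕ} (hρ₀ : ∀ ω : Fin N, ((univ : Finset (Fin N)).filter fun ω' => ∃ q, Ft ω q * Ft ω' q ≠ 0).card ≤ ρ₀)
    (sym : ι → FreqMomentum L M × Fin 2 → ℂ) (τ : Fin k → ι) (κ : ι → ℝ)
    (hκF : ∀ (s : ι) (Y : SpaceTimeIdx L M × SectorLeg N), Y.2.2 = 0 → ‖sectorGramF L M β Ft (sym s) Y‖ ≤ κ s)
    (hκG : ∀ (s : ι) (Y : SpaceTimeIdx L M × SectorLeg N), Y.2.2 = 1 → ‖sectorGramG L M β Ft (sym s) Y‖ ≤ κ s)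
    (a b : GrassmannAlgebra ℂ (SpaceTimeIdx L M × SectorLeg N)) (s : Fin m → Fin 2)
    (hm₀ : (univ.filter fun i => s i = 0).card = m₀) (hm₁ : (univ.filter fun i => s i = 1).card = m₁)
    (Z : Fin m → SpaceTimeIdx L M × SectorLeg N) {α : ℝ} (hα : 0 ≤ α)
    (hrow : ∀ X, ∑ Y, ‖((sectorSubMatrix L M β Ft).transpose * normalCovariance L M (sym (τ (Fin.castLE he 0))) * sectorSubMatrix L M β Ft) X Y‖ ≤ α)
    (hcol : ∀ Y, ∑ X, ‖((sectorSubMatrix L M β Ft).transpose * normalCovariance L M (sym (τ (Fin.castLE he 0))) * sectorSubMatrix L M β Ft) X Y‖ ≤ α)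
    (δ : Fin e' → ℝ) (hδ : ∀ i, 0 ≤ δ i)
    (hent : ∀ (i : Fin e') X Y,
      ‖((sectorSubMatrix L M β Ft).transpose * normalCovariance L M (sym (τ (Fin.castLE he i.succ))) * sectorSubMatrix L M β Ft) X Y‖ ≤ δ i)
    {Na Nb : ℝ} (hNa0 : 0 ≤ Na)
    (hNa : ∀ (X₀ : SpaceTimeIdx L M × SectorLeg N) (σ' : Fin e' → SectorLeg N) (Z₀ : Fin m₀ → SpaceTimeIdx L M × SectorLeg N),
      ∑ x : Fin e' → SpaceTimeIdx L M, ∑ X ∈ univ.filter (fun X : Fin k → SpaceTimeIdx L M × SectorLeg N =>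
        (fun i => X (Fin.castLE he i)) = (Fin.cons X₀ (fun i => (x i, σ' i)) : Fin (e' + 1) → SpaceTimeIdx L M × SectorLeg N)),
          ‖kernel ℂ a (k + m₀) (Fin.append X Z₀)‖ ≤ Na)
    (hNb : ∀ Y₁ : Fin m₁ → SpaceTimeIdx L M × SectorLeg N, ∑ Y : Fin k → SpaceTimeIdx L M × SectorLeg N,
      ‖kernel ℂ b (k + m₁) (Fin.append Y Y₁)‖ ≤ Nb) :
    ‖kernel ℂ (((List.ofFn fun i => grassmannLaplacian ℂ (crossCov ℂ
        ((sectorSubMatrix L M β Ft).transpose * normalCovariance L M (sym (τ i)) * sectorSubMatrix L M β Ft))).reverse).prod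
        (dblCopy ℂ 0 a * dblCopy ℂ 1 b)) m (fun i => (Z i, s i))‖ ≤
      (((k + m₀).factorial * (k + m₁).factorial : ℝ) / (m.factorial * (k - (e' + 1)).factorial)) * (∑ t, κ t ^ 2) ^ (k - (e' + 1)) *
        (α * (∏ i, δ i * ((4 * ρ₀ : ℕ) : ℝ)) * Na * Nb) := by
  classical
  refine norm_kernel_crossContract_value_le_gram_of_b (fun Y : SpaceTimeIdx L M × SectorLeg N => decide (Y.2.2 = 0))
    (fun t => (sectorSubMatrix L M β Ft).transpose * normalCovariance L M (sym t) * sectorSubMatrix L M β Ft)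
    (fun t X Y hq => pullback_normalCovariance_apply_of_charge_eq β Ft (sym t) (fin_two_eq_of_iff (by simpa using hq)))
    (fun t => sectorGramF L M β Ft (sym t)) (fun t => sectorGramG L M β Ft (sym t)) κ
    (fun t X hX => hκF t X (by simpa using hX)) (fun t Y hY => hκG t Y ?_)
    (fun t X Y hX hY => contr_pullback_normalCovariance_eq_inner β Ft (sym t) (by simpa using hX) ?_)
    he (fun i => (sectorSubMatrix L M β Ft).transpose * normalCovariance L M (sym (τ i)) * sectorSubMatrix L M β Ft) τ (fun i _ => rfl)
    a b s hm₀ hm₁ Z hα (sum_norm_contr_le _ hrow hcol)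
    (fun _ σ τ'' => if (∃ q, Ft σ.1.1 q * Ft τ''.1.1 q ≠ 0) then (1 : ℝ) else 0) (fun _ σ τ'' => by positivity)
    δ (fun _ => ((4 * ρ₀ : ℕ) : ℝ)) hδ (fun _ => by positivity)
    (fun i X Y => norm_contr_le_indicator_of_support _ (fun σ τ'' : SectorLeg N => ∃ q, Ft σ.1.1 q * Ft τ''.1.1 q ≠ 0)
      (fun σ τ'' ⟨q, hq⟩ => ⟨q, by rwa [mul_comm] at hq⟩) (hδ i) (hent i)
      (fun X Y hXY => exists_mul_ne_zero_of_pullback_normalCovariance_ne_zero β Ft (sym _) hXY) X Y)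
    (fun _ τ'' => sum_indicator_le_of_card_le' (fun σ τ'' : SectorLeg N => ∃ q, Ft σ.1.1 q * Ft τ''.1.1 q ≠ 0)
      (fun σ τ'' ⟨q, hq⟩ => ⟨q, by rwa [mul_comm] at hq⟩) (fun σ' => ?_) τ'') hNa0 hNa hNb
  · have h2 : (Y.2.2 : Fin 2) ≠ 0 := by simpa using hY
    omega
  · have h2 : (Y.2.2 : Fin 2) ≠ 0 := by simpa using hY
    omega
  · exact (card_filter_sectorLeg_le fun ω' => ∃ q, Ft σ'.1.1 q * Ft ω' q ≠ 0).trans (Nat.mul_le_mul_left 4 (hρ₀ σ'.1.1))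

/-- **Engine currency, finite symbol family** (lines via `Ft`, vertices the `F`-sector preimages; `m₀ + 1` output legs from `a`): `Ga` at `F`-level
`m₀ + 1`, `Gb` at `F`-level `e' + 1 + m₁`; Gram base `Σ_{s∈ι} κ_s²`. [cite: BenfattoGiulianiMastropietro2006, §2.8 (2.80)] -/
theorem norm_kernel_crossContract_value_sectorPreimage_le_gramF {k e' m m₀ m₁ : ℕ} (he : e' + 1 ≤ k) {β : ℝ} (hβ : 0 ≤ β)
    (F Ft : Fin N → FreqMomentum L M → ℂ)
    {ρ₀ : ℕ} (hρ₀ : ∀ ω : Fin N, ((univ : Finset (Fin N)).filter fun ω' => ∃ q, Ft ω q * Ft ω' q ≠ 0).card ≤ ρ₀)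
    (sym : ι → FreqMomentum L M × Fin 2 → ℂ) (τ : Fin k → ι) (κ : ι → ℝ)
    (hκF : ∀ (s : ι) (Y : SpaceTimeIdx L M × SectorLeg N), Y.2.2 = 0 → ‖sectorGramF L M β Ft (sym s) Y‖ ≤ κ s)
    (hκG : ∀ (s : ι) (Y : SpaceTimeIdx L M × SectorLeg N), Y.2.2 = 1 → ‖sectorGramG L M β Ft (sym s) Y‖ ≤ κ s)
    (Ga Gb : HubbardGrassmann L M) (s : Fin m → Fin 2)
    (hm₀ : (univ.filter fun i => s i = 0).card = m₀ + 1) (hm₁ : (univ.filter fun i => s i = 1).card = m₁)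
    (Z : Fin m → SpaceTimeIdx L M × SectorLeg N) {α : ℝ} (hα : 0 ≤ α)
    (hrow : ∀ X, ∑ Y, ‖((sectorSubMatrix L M β Ft).transpose * normalCovariance L M (sym (τ (Fin.castLE he 0))) * sectorSubMatrix L M β Ft) X Y‖ ≤ α)
    (hcol : ∀ Y, ∑ X, ‖((sectorSubMatrix L M β Ft).transpose * normalCovariance L M (sym (τ (Fin.castLE he 0))) * sectorSubMatrix L M β Ft) X Y‖ ≤ α)
    (δ : Fin e' → ℝ) (hδ : ∀ i, 0 ≤ δ i)
    (hent : ∀ (i : Fin e') X Y,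
      ‖((sectorSubMatrix L M β Ft).transpose * normalCovariance L M (sym (τ (Fin.castLE he i.succ))) * sectorSubMatrix L M β Ft) X Y‖ ≤ δ i)
    {Na Nb : ℝ} (hNb0 : 0 ≤ Nb)
    (hNa : ∀ σ₀ : Fin (m₀ + 1) → SectorLeg N, hubbardSectorKernelNorm L M β F (prescribedTuples univ
      (Fin.append (fun _ : Fin k => (none : Option (SectorLeg N))) (fun j => some (σ₀ j)))) Ga ≤ Na)
    (hNb : ∀ (ω₀ : SectorLeg N) (τ' : Fin e' → SectorLeg N) (ω₁ : Fin m₁ → SectorLeg N),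
      hubbardSectorKernelNorm L M β F (prescribedTuples univ
        (Fin.append (fun i : Fin k => if h : (i : ℕ) < e' + 1 then some ((Fin.cons ω₀ τ' : Fin (e' + 1) → SectorLeg N) ⟨i, h⟩) else none)
          (fun j => some (ω₁ j)))) Gb ≤ Nb) :
    ‖kernel ℂ (((List.ofFn fun i => grassmannLaplacian ℂ (crossCov ℂ
        ((sectorSubMatrix L M β Ft).transpose * normalCovariance L M (sym (τ i)) * sectorSubMatrix L M β Ft))).reverse).prod
        (dblCopy ℂ 0 (sectorPreimage β F Ga) * dblCopy ℂ 1 (sectorPreimage β F Gb))) m (fun i => (Z i, s i))‖ ≤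
      (((k + (m₀ + 1)).factorial * (k + m₁).factorial : ℝ) / (m.factorial * (k - (e' + 1)).factorial)) *
        (∑ t, κ t ^ 2) ^ (k - (e' + 1)) *
        (α * (∏ i, δ i * ((4 * ρ₀ : ℕ) : ℝ)) * (imagTimeWeight β M * Na) * (imagTimeWeight β M * Nb)) :=
  norm_kernel_crossContract_value_pullback_le_gramF he β Ft hρ₀ sym τ κ hκF hκG (sectorPreimage β F Ga) (sectorPreimage β F Gb) s hm₀ hm₁ Z
    hα hrow hcol δ hδ hent (mul_nonneg (imagTimeWeight_nonneg hβ M) hNb0)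
    (fun X₀ => (sum_fixed_norm_kernel_sectorPreimage_le hβ F Ga X₀).trans
      (mul_le_mul_of_nonneg_left (hNa _) (imagTimeWeight_nonneg hβ M)))
    fun Y₀ τ' Y₁ => (sum_sum_filter_castLE_norm_kernel_sectorPreimage_le hβ F Gb he Y₀ τ' Y₁).trans
      (mul_le_mul_of_nonneg_left (hNb _ _ _) (imagTimeWeight_nonneg hβ M))

/-- **Engine currency, finite symbol family, roles exchanged** (every output leg may come from `b`): `Ga` at `F`-level `e' + 1 + m₀`, `Gb` at
`F`-level `m₁ + 1`. [cite: BenfattoGiulianiMastropietro2006, §2.8 (2.80)] -/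
theorem norm_kernel_crossContract_value_sectorPreimage_le_gramF_of_b {k e' m m₀ m₁ : ℕ} (he : e' + 1 ≤ k) {β : ℝ} (hβ : 0 ≤ β)
    (F Ft : Fin N → FreqMomentum L M → ℂ)
    {ρ₀ : ℕ} (hρ₀ : ∀ ω : Fin N, ((univ : Finset (Fin N)).filter fun ω' => ∃ q, Ft ω q * Ft ω' q ≠ 0).card ≤ ρ₀)
    (sym : ι → FreqMomentum L M × Fin 2 → ℂ) (τ : Fin k → ι) (κ : ι → ℝ)
    (hκF : ∀ (s : ι) (Y : SpaceTimeIdx L M × SectorLeg N), Y.2.2 = 0 → ‖sectorGramF L M β Ft (sym s) Y‖ ≤ κ s)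
    (hκG : ∀ (s : ι) (Y : SpaceTimeIdx L M × SectorLeg N), Y.2.2 = 1 → ‖sectorGramG L M β Ft (sym s) Y‖ ≤ κ s)
    (Ga Gb : HubbardGrassmann L M) (s : Fin m → Fin 2)
    (hm₀ : (univ.filter fun i => s i = 0).card = m₀) (hm₁ : (univ.filter fun i => s i = 1).card = m₁ + 1)
    (Z : Fin m → SpaceTimeIdx L M × SectorLeg N) {α : ℝ} (hα : 0 ≤ α)
    (hrow : ∀ X, ∑ Y, ‖((sectorSubMatrix L M β Ft).transpose * normalCovariance L M (sym (τ (Fin.castLE he 0))) * sectorSubMatrix L M β Ft) X Y‖ ≤ α)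
    (hcol : ∀ Y, ∑ X, ‖((sectorSubMatrix L M β Ft).transpose * normalCovariance L M (sym (τ (Fin.castLE he 0))) * sectorSubMatrix L M β Ft) X Y‖ ≤ α)
    (δ : Fin e' → ℝ) (hδ : ∀ i, 0 ≤ δ i)
    (hent : ∀ (i : Fin e') X Y,
      ‖((sectorSubMatrix L M β Ft).transpose * normalCovariance L M (sym (τ (Fin.castLE he i.succ))) * sectorSubMatrix L M β Ft) X Y‖ ≤ δ i)
    {Na Nb : ℝ} (hNa0 : 0 ≤ Na)
    (hNa : ∀ (ω₀ : SectorLeg N) (σ' : Fin e' → SectorLeg N) (ω₁ : Fin m₀ → SectorLeg N),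
      hubbardSectorKernelNorm L M β F (prescribedTuples univ
        (Fin.append (fun i : Fin k => if h : (i : ℕ) < e' + 1 then some ((Fin.cons ω₀ σ' : Fin (e' + 1) → SectorLeg N) ⟨i, h⟩) else none)
          (fun j => some (ω₁ j)))) Ga ≤ Na)
    (hNb : ∀ σ₁ : Fin (m₁ + 1) → SectorLeg N, hubbardSectorKernelNorm L M β F (prescribedTuples univ
      (Fin.append (fun _ : Fin k => (none : Option (SectorLeg N))) (fun j => some (σ₁ j)))) Gb ≤ Nb) :
    ‖kernel ℂ (((List.ofFn fun i => grassmannLaplacian ℂ (crossCov ℂ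
        ((sectorSubMatrix L M β Ft).transpose * normalCovariance L M (sym (τ i)) * sectorSubMatrix L M β Ft))).reverse).prod
        (dblCopy ℂ 0 (sectorPreimage β F Ga) * dblCopy ℂ 1 (sectorPreimage β F Gb))) m (fun i => (Z i, s i))‖ ≤
      (((k + m₀).factorial * (k + (m₁ + 1)).factorial : ℝ) / (m.factorial * (k - (e' + 1)).factorial)) *
        (∑ t, κ t ^ 2) ^ (k - (e' + 1)) *
        (α * (∏ i, δ i * ((4 * ρ₀ : ℕ) : ℝ)) * (imagTimeWeight β M * Na) * (imagTimeWeight β M * Nb)) :=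
  norm_kernel_crossContract_value_pullback_le_gramF_of_b he β Ft hρ₀ sym τ κ hκF hκG (sectorPreimage β F Ga) (sectorPreimage β F Gb) s hm₀ hm₁ Z
    hα hrow hcol δ hδ hent (mul_nonneg (imagTimeWeight_nonneg hβ M) hNa0)
    (fun X₀ σ' Z₀ => (sum_sum_filter_castLE_norm_kernel_sectorPreimage_le hβ F Ga he X₀ σ' Z₀).trans
      (mul_le_mul_of_nonneg_left (hNa _ _ _) (imagTimeWeight_nonneg hβ M)))
    fun Y₁ => (sum_fixed_norm_kernel_sectorPreimage_le hβ F Gb Y₁).trans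
      (mul_le_mul_of_nonneg_left (hNb _) (imagTimeWeight_nonneg hβ M))

end Family

/-! ## On `klAnisoFamily … n` (family keying; thin family `klAnisoFamily … e₀ n`, fat family `Ft` of the transport) -/

section AnisoFamily

open Summit.HubbardSuperconductivity.HubbardSuperconductivity.Theorems.KLProgrammeLegKernels
open Summit.HubbardSuperconductivity.HubbardSuperconductivity.Theorems.PerturbedFermiCurve

variable {L M : ℕ} [NeZero L] {ι : Type*} [Fintype ι] [DecidableEq ι] {e₀ : ℝ} {β : ℝ} (hβ : 0 ≤ β) (μ : ℝ) (K : TrigPolyC4v) (n : ℕ)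
include hβ

/-- **Engine currency on `klAnisoFamily … n` vertices, finite symbol family, any fat transport family `Ft` with overlap count `ρ₀`**
(`m₀ + 1` output legs from `a`): `Ga` at level `m₀ + 1`, `Gb` at level `e' + 1 + m₁` of `klAnisoFamily L M β μ K e₀ n`; Gram base `Σ_{s∈ι} κ_s²`.
[cite: BenfattoGiulianiMastropietro2006, §2.8 (2.80)] -/
theorem norm_kernel_crossContract_value_klAnisoPreimage_le_gramF {k e' m m₀ m₁ : ℕ} (he : e' + 1 ≤ k)
    (Ft : Fin (sectorCount n) → FreqMomentum L M → ℂ)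
    {ρ₀ : ℕ} (hρ₀ : ∀ ω : Fin (sectorCount n), ((univ : Finset (Fin (sectorCount n))).filter fun ω' => ∃ q, Ft ω q * Ft ω' q ≠ 0).card ≤ ρ₀)
    (sym : ι → FreqMomentum L M × Fin 2 → ℂ) (τ : Fin k → ι) (κ : ι → ℝ)
    (hκF : ∀ (s : ι) (Y : SpaceTimeIdx L M × SectorLeg (sectorCount n)), Y.2.2 = 0 → ‖sectorGramF L M β Ft (sym s) Y‖ ≤ κ s)
    (hκG : ∀ (s : ι) (Y : SpaceTimeIdx L M × SectorLeg (sectorCount n)), Y.2.2 = 1 → ‖sectorGramG L M β Ft (sym s) Y‖ ≤ κ s)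
    (Ga Gb : HubbardGrassmann L M) (s : Fin m → Fin 2)
    (hm₀ : (univ.filter fun i => s i = 0).card = m₀ + 1) (hm₁ : (univ.filter fun i => s i = 1).card = m₁)
    (Z : Fin m → SpaceTimeIdx L M × SectorLeg (sectorCount n)) {α : ℝ} (hα : 0 ≤ α)
    (hrow : ∀ X, ∑ Y, ‖((sectorSubMatrix L M β Ft).transpose * normalCovariance L M (sym (τ (Fin.castLE he 0))) * sectorSubMatrix L M β Ft) X Y‖ ≤ α)
    (hcol : ∀ Y, ∑ X, ‖((sectorSubMatrix L M β Ft).transpose * normalCovariance L M (sym (τ (Fin.castLE he 0))) * sectorSubMatrix L M β Ft) X Y‖ ≤ α)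
    (δ : Fin e' → ℝ) (hδ : ∀ i, 0 ≤ δ i)
    (hent : ∀ (i : Fin e') X Y,
      ‖((sectorSubMatrix L M β Ft).transpose * normalCovariance L M (sym (τ (Fin.castLE he i.succ))) * sectorSubMatrix L M β Ft) X Y‖ ≤ δ i)
    {Na Nb : ℝ} (hNb0 : 0 ≤ Nb)
    (hNa : ∀ σ₀ : Fin (m₀ + 1) → SectorLeg (sectorCount n), hubbardSectorKernelNorm L M β (klAnisoFamily L M β μ K e₀ n) (prescribedTuples univ
      (Fin.append (fun _ : Fin k => (none : Option (SectorLeg (sectorCount n)))) (fun j => some (σ₀ j)))) Ga ≤ Na)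
    (hNb : ∀ (ω₀ : SectorLeg (sectorCount n)) (τ' : Fin e' → SectorLeg (sectorCount n)) (ω₁ : Fin m₁ → SectorLeg (sectorCount n)),
      hubbardSectorKernelNorm L M β (klAnisoFamily L M β μ K e₀ n) (prescribedTuples univ
        (Fin.append (fun i : Fin k => if h : (i : ℕ) < e' + 1 then some ((Fin.cons ω₀ τ' : Fin (e' + 1) → SectorLeg (sectorCount n)) ⟨i, h⟩)
          else none) (fun j => some (ω₁ j)))) Gb ≤ Nb) :
    ‖kernel ℂ (((List.ofFn fun i => grassmannLaplacian ℂ (crossCov ℂ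
        ((sectorSubMatrix L M β Ft).transpose * normalCovariance L M (sym (τ i)) * sectorSubMatrix L M β Ft))).reverse).prod
        (dblCopy ℂ 0 (sectorPreimage β (klAnisoFamily L M β μ K e₀ n) Ga) *
          dblCopy ℂ 1 (sectorPreimage β (klAnisoFamily L M β μ K e₀ n) Gb))) m (fun i => (Z i, s i))‖ ≤
      (((k + (m₀ + 1)).factorial * (k + m₁).factorial : ℝ) / (m.factorial * (k - (e' + 1)).factorial)) *
        (∑ t, κ t ^ 2) ^ (k - (e' + 1)) *
        (α * (∏ i, δ i * ((4 * ρ₀ : ℕ) : ℝ)) * (imagTimeWeight β M * Na) * (imagTimeWeight β M * Nb)) :=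
  norm_kernel_crossContract_value_sectorPreimage_le_gramF he hβ (klAnisoFamily L M β μ K e₀ n) Ft hρ₀ sym τ κ hκF hκG Ga Gb s hm₀ hm₁ Z hα
    hrow hcol δ hδ hent hNb0 hNa hNb

/-- **The same, roles exchanged** (every output leg may come from `b`). [cite: BenfattoGiulianiMastropietro2006, §2.8 (2.80)] -/
theorem norm_kernel_crossContract_value_klAnisoPreimage_le_gramF_of_b {k e' m m₀ m₁ : ℕ} (he : e' + 1 ≤ k)
    (Ft : Fin (sectorCount n) → FreqMomentum L M → ℂ)
    {ρ₀ : ℕ} (hρ₀ : ∀ ω : Fin (sectorCount n), ((univ : Finset (Fin (sectorCount n))).filter fun ω' => ∃ q, Ft ω q * Ft ω' q ≠ 0).card ≤ ρ₀)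
    (sym : ι → FreqMomentum L M × Fin 2 → ℂ) (τ : Fin k → ι) (κ : ι → ℝ)
    (hκF : ∀ (s : ι) (Y : SpaceTimeIdx L M × SectorLeg (sectorCount n)), Y.2.2 = 0 → ‖sectorGramF L M β Ft (sym s) Y‖ ≤ κ s)
    (hκG : ∀ (s : ι) (Y : SpaceTimeIdx L M × SectorLeg (sectorCount n)), Y.2.2 = 1 → ‖sectorGramG L M β Ft (sym s) Y‖ ≤ κ s)
    (Ga Gb : HubbardGrassmann L M) (s : Fin m → Fin 2)
    (hm₀ : (univ.filter fun i => s i = 0).card = m₀) (hm₁ : (univ.filter fun i => s i = 1).card = m₁ + 1)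
    (Z : Fin m → SpaceTimeIdx L M × SectorLeg (sectorCount n)) {α : ℝ} (hα : 0 ≤ α)
    (hrow : ∀ X, ∑ Y, ‖((sectorSubMatrix L M β Ft).transpose * normalCovariance L M (sym (τ (Fin.castLE he 0))) * sectorSubMatrix L M β Ft) X Y‖ ≤ α)
    (hcol : ∀ Y, ∑ X, ‖((sectorSubMatrix L M β Ft).transpose * normalCovariance L M (sym (τ (Fin.castLE he 0))) * sectorSubMatrix L M β Ft) X Y‖ ≤ α)
    (δ : Fin e' → ℝ) (hδ : ∀ i, 0 ≤ δ i)
    (hent : ∀ (i : Fin e') X Y,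
      ‖((sectorSubMatrix L M β Ft).transpose * normalCovariance L M (sym (τ (Fin.castLE he i.succ))) * sectorSubMatrix L M β Ft) X Y‖ ≤ δ i)
    {Na Nb : ℝ} (hNa0 : 0 ≤ Na)
    (hNa : ∀ (ω₀ : SectorLeg (sectorCount n)) (σ' : Fin e' → SectorLeg (sectorCount n)) (ω₁ : Fin m₀ → SectorLeg (sectorCount n)),
      hubbardSectorKernelNorm L M β (klAnisoFamily L M β μ K e₀ n) (prescribedTuples univ
        (Fin.append (fun i : Fin k => if h : (i : ℕ) < e' + 1 then some ((Fin.cons ω₀ σ' : Fin (e' + 1) → SectorLeg (sectorCount n)) ⟨i, h⟩)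
          else none) (fun j => some (ω₁ j)))) Ga ≤ Na)
    (hNb : ∀ σ₁ : Fin (m₁ + 1) → SectorLeg (sectorCount n), hubbardSectorKernelNorm L M β (klAnisoFamily L M β μ K e₀ n) (prescribedTuples univ
      (Fin.append (fun _ : Fin k => (none : Option (SectorLeg (sectorCount n)))) (fun j => some (σ₁ j)))) Gb ≤ Nb) :
    ‖kernel ℂ (((List.ofFn fun i => grassmannLaplacian ℂ (crossCov ℂ
        ((sectorSubMatrix L M β Ft).transpose * normalCovariance L M (sym (τ i)) * sectorSubMatrix L M β Ft))).reverse).prod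
        (dblCopy ℂ 0 (sectorPreimage β (klAnisoFamily L M β μ K e₀ n) Ga) *
          dblCopy ℂ 1 (sectorPreimage β (klAnisoFamily L M β μ K e₀ n) Gb))) m (fun i => (Z i, s i))‖ ≤
      (((k + m₀).factorial * (k + (m₁ + 1)).factorial : ℝ) / (m.factorial * (k - (e' + 1)).factorial)) *
        (∑ t, κ t ^ 2) ^ (k - (e' + 1)) *
        (α * (∏ i, δ i * ((4 * ρ₀ : ℕ) : ℝ)) * (imagTimeWeight β M * Na) * (imagTimeWeight β M * Nb)) :=
  norm_kernel_crossContract_value_sectorPreimage_le_gramF_of_b he hβ (klAnisoFamily L M β μ K e₀ n) Ft hρ₀ sym τ κ hκF hκG Ga Gb s hm₀ hm₁ Z hα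
    hrow hcol δ hδ hent hNa0 hNa hNb

end AnisoFamily

end Summit.HubbardSuperconductivity.HubbardSuperconductivity.Theorems.KLRegimeWick

end
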